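import Literature.Analysis.FluidPDE.ForwardDSSExistenceLocalProofs
import Literature.Analysis.FluidPDE.LocalTypeILscGradientTools
import Literature.Analysis.FluidPDE.RepresentedDerivativesCalculus
import Literature.Analysis.FluidPDE.SuitableWeak
import Literature.Analysis.FluidPDE.LerayHopfProofs
import HarnessLib

/-!
# Weak gradient a.e. zero ⇒ a.e.-constant slices; the STEADY stratum of the power-gauge Euler
# Liouville crux (§B CANDIDATE 1 `EulerZoomLiouville.PowerGaugeEulerLiouville`, rung B) — first rungs
# for the Type-II-exclusion programme on `TypeIliouvilleNoTypeII` (stmt-NavierStokesRegularity-0056)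

Helper file (theorems only).  Two kernel facts for the route `EulerZoomLiouville` requested OPEN by
DIRECTOR-NS (#12) on critic-2's K-READ 01 of «§B CANDIDATE 1» (lens oqh): its deciding crux
`PowerGaugeEulerLiouville` is a Liouville theorem for ancient suitable weak EULER flows `(u, p)` on
`(−∞, 0) × ℝ³` with weak spatial gradient `H` obeying Seregin's power-gauged bound
`a^{2ρ} A(a) + a^{ρ} E(a) + a^{2ρ} D(a) ≤ c` at the origin for all `a > 0` (`ρ > 0`).  The planner's
rung B («steady members vanish for every `ρ > 0`») was left PLAN-ONLY for want of the step «weak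
gradient zero ⇒ constant».  This file supplies that step from tree parts and proves the steady rung
in the sub-stratum where the weak gradient is steady too:
* `ae_slice_const_of_weakGradient_ae_zero` — if `u` has weak spatial gradient `G` on a slab
  `I × ℝ³` and `G = 0` a.e. there, then for a.e. `t ∈ I` the slice `u t` is a.e. CONSTANT (the tree's
  «`∇F = 0` distributionally ⇒ `F = c(t)`», `ae_restrict_exists_ae_eq_const_of_forall_integral_mul_fderiv_eq_zero`,
  fed by the set-integral form of the weak-gradient identity `setIntegral_mul_inner_weakGradient_eq`,
  componentwise);
* `lintegral_ball_frobeniusNormSq_le_of_gaugedE` — for a STEADY gradient field `H(t, ·) = H₀` the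
  gauged `E`-bound `a^ρ E(H; Q_a(0)) ≤ c` reads `∫_{B_a} |H₀|²_F ≤ c · a^{−1−ρ}`;
* `weakGradient_ae_zero_of_gaugedE_steady` — hence `H₀ = 0` a.e. (let `a → ∞`);
* `powerGauge_steady_ae_const` — so a steady field `u(t, ·) = U` with steady weak gradient obeying
  the gauged `E`-bound is a.e. constant;
* `powerGauge_steady_eq_zero` — and the gauged `A`-bound `a^{2ρ} A(a) ≤ c` kills the constant:
  **the steady-with-steady-gradient stratum of `PowerGaugeEulerLiouville` holds for every `ρ > 0`**
  (no Euler input, no pressure, no suitability used — exactly as for the steady stratum of EEL′).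
The general steady stratum (steady `u`, arbitrary weak gradient `H`) needs one more step — time
averaging of `H` against time-shifted tests (HOME/HANDOFF.md § ns-typeII-p3, spec F1).
WHAT THIS IS NOT: not NS; nothing here bears on regularity or blow-up; the crux itself is OPEN on
`ρ ∈ (0, 1/2]`. [folklore]
-/

noncomputable section

-- the summit and its single problem share the name `NavierStokesRegularity` (D-0017 nested layout)
set_option linter.dupNamespace false

open Set Function Filter Topology MeasureTheory Metric TopologicalSpace
open scoped NNReal ENNReal InnerProductSpace RealInnerProductSpace

namespace Summit.NavierStokesRegularity.NavierStokesRegularity.Theorems.TypeIliouvilleNoTypeII.PowerGaugeSteady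

open Literature.Analysis Literature.Analysis.FluidPDE

/-! ## Weak gradient a.e. zero ⇒ a.e.-constant slices -/

/-- **A field whose weak spatial gradient vanishes a.e. on a slab has a.e.-constant slices.**  If
`u : ℝ → ℝ³ → ℝ³` has weak spatial gradient `G` on the slab `I × ℝ³` (`I` open) and `G = 0` a.e. on
the slab, then for a.e. `t ∈ I` there is `b` with `u t = b` a.e. on `ℝ³`. [folklore] -/
theorem ae_slice_const_of_weakGradient_ae_zero {I : Set ℝ} (hI : IsOpen I)
    {u : ℝ → EuclideanSpace ℝ (Fin 3) → EuclideanSpace ℝ (Fin 3)}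
    {G : ℝ → EuclideanSpace ℝ (Fin 3) → EuclideanSpace ℝ (Fin 3) →L[ℝ] EuclideanSpace ℝ (Fin 3)}
    (hG : HasWeakSpatialGradientOn (slab (EuclideanSpace ℝ (Fin 3)) I hI) u G)
    (h0 : ∀ᵐ z ∂(volume.restrict (I ×ˢ (univ : Set (EuclideanSpace ℝ (Fin 3))))), G z.1 z.2 = 0) :
    ∀ᵐ t ∂(volume.restrict I), ∃ b : EuclideanSpace ℝ (Fin 3), u t =ᵐ[volume] fun _ => b := by
  set Q : Opens (ℝ × EuclideanSpace ℝ (Fin 3)) := slab (EuclideanSpace ℝ (Fin 3)) I hI with hQdef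
  have hQ : (Q : Set (ℝ × EuclideanSpace ℝ (Fin 3))) = I ×ˢ univ := rfl
  -- componentwise: each coordinate `⟪u, e_i⟫` is weakly gradient-free on the slab
  have hcomp : ∀ i : Fin 3, ∀ᵐ t ∂(volume.restrict I), ∃ c : ℝ,
      (fun x => ⟪u t x, EuclideanSpace.single i (1 : ℝ)⟫) =ᵐ[volume] fun _ => c := by
    intro i
    set w : EuclideanSpace ℝ (Fin 3) := EuclideanSpace.single i (1 : ℝ) with hw
    have hF : LocallyIntegrableOn (uncurry fun t x => ⟪u t x, w⟫)
        ((Q : Set (ℝ × EuclideanSpace ℝ (Fin 3)))) volume :=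
      RepDeriv.locallyIntegrableOn_inner_const hG.locallyIntegrableOn w
    refine ae_restrict_exists_ae_eq_const_of_forall_integral_mul_fderiv_eq_zero hI hF ?_
    intro θ hθ v
    -- the weak-gradient identity in set-integral form, with `G = 0` a.e. on the slab
    have hid := setIntegral_mul_inner_weakGradient_eq hG hθ v w
    have hzero : ∫ z in (Q : Set (ℝ × EuclideanSpace ℝ (Fin 3))), θ z.1 z.2 * ⟪G z.1 z.2 v, w⟫ = 0 := by
      refine setIntegral_eq_zero_of_ae_eq_zero ?_
      rw [hQ]
      filter_upwards [ae_imp_of_ae_restrict h0] with z hz hzQ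
      rw [hz hzQ]
      simp
    rw [hzero] at hid
    have hall : ∫ z : ℝ × EuclideanSpace ℝ (Fin 3), fderiv ℝ (θ z.1) z.2 v * ⟪u z.1 z.2, w⟫ = 0 := by
      linarith
    -- off the slab the integrand vanishes (the slice `θ t` is identically zero for `t ∉ I`)
    have hoff : ∀ z ∉ (Q : Set (ℝ × EuclideanSpace ℝ (Fin 3))),
        ⟪u z.1 z.2, w⟫ * fderiv ℝ (θ z.1) z.2 v = 0 := by
      intro z hz
      have hzI : z.1 ∉ I := fun h => hz (by rw [hQ]; exact ⟨h, mem_univ _⟩)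
      have hθ0 : θ z.1 = fun _ => 0 := funext fun x =>
        hθ.apply_eq_zero (t := z.1) (x := x) (by rw [hQ]; exact fun h => hzI h.1)
      rw [hθ0]
      simp
    show ∫ z in (Q : Set (ℝ × EuclideanSpace ℝ (Fin 3))), ⟪u z.1 z.2, w⟫ * fderiv ℝ (θ z.1) z.2 v = 0
    rw [setIntegral_eq_integral_of_forall_compl_eq_zero hoff]
    simpa [mul_comm] using hall
  -- assemble the three coordinates
  have hall := ae_all_iff.2 hcomp
  filter_upwards [hall] with t ht
  choose c hc using ht
  have hae : ∀ᵐ x ∂volume, ∀ i, ⟪u t x, EuclideanSpace.single i (1 : ℝ)⟫ = c i :=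
    ae_all_iff.2 fun i => hc i
  -- pick a point `x₁` in the full-measure set; the constant is `u t x₁`
  obtain ⟨x₁, hx₁⟩ := hae.exists
  refine ⟨u t x₁, ?_⟩
  filter_upwards [hae] with x hx
  ext i
  have h1 := hx i
  have h2 := hx₁ i
  rw [EuclideanSpace.inner_single_right] at h1 h2
  simp only [one_mul, conj_trivial] at h1 h2
  rw [h1, h2]

/-! ## The gauged `E`-bound for a steady gradient field -/

/-- Space–time integral of a time-independent a.e.-measurable integrand over `(a, b) × B`:
`∫∫ f(y) = |(a,b)| · ∫_B f`. [folklore] -/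
theorem setLIntegral_Ioo_prod_snd {f : EuclideanSpace ℝ (Fin 3) → ℝ≥0∞}
    {B : Set (EuclideanSpace ℝ (Fin 3))} (hf : AEMeasurable f (volume.restrict B)) (a b : ℝ) :
    ∫⁻ q in Ioo a b ×ˢ B, f q.2 = volume (Ioo a b) * ∫⁻ y in B, f y := by
  have hμ : (volume : Measure (ℝ × EuclideanSpace ℝ (Fin 3))).restrict (Ioo a b ×ˢ B) =
      (volume.restrict (Ioo a b)).prod (volume.restrict B) := by
    rw [Measure.volume_eq_prod, Measure.prod_restrict]
  rw [hμ, lintegral_prod (fun q : ℝ × EuclideanSpace ℝ (Fin 3) => f q.2)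
    (hf.comp_quasiMeasurePreserving Measure.quasiMeasurePreserving_snd)]
  simp only [lintegral_const, Measure.restrict_apply_univ, mul_comm]

/-- **The gauged `E`-bound of a steady gradient field**: if `H(t, ·) = H₀` for `t < 0`, with `H₀`
a.e.-strongly measurable, and `a^ρ · E(H; Q_a(0,0)) ≤ c`, then `∫_{B_a(0)} |H₀|²_F ≤ c · a^{−1−ρ}`
(`E(H; Q_a(0)) = a⁻¹ · a² · ∫_{B_a}|H₀|²_F`). [folklore] -/
theorem lintegral_ball_frobeniusNormSq_le_of_gaugedE
    {H₀ : EuclideanSpace ℝ (Fin 3) → EuclideanSpace ℝ (Fin 3) →L[ℝ] EuclideanSpace ℝ (Fin 3)}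
    (hH₀ : AEStronglyMeasurable H₀ volume) {ρ c a : ℝ} (ha : 0 < a)
    (hE : ENNReal.ofReal (a ^ ρ) * cknE a ((0 : ℝ), (0 : EuclideanSpace ℝ (Fin 3))) (fun _ => H₀) ≤
      ENNReal.ofReal c) :
    ∫⁻ y in ball (0 : EuclideanSpace ℝ (Fin 3)) a, ENNReal.ofReal (frobeniusNormSq (H₀ y)) ≤
      ENNReal.ofReal (c * a ^ (-1 - ρ)) := by
  set J : ℝ≥0∞ := ∫⁻ y in ball (0 : EuclideanSpace ℝ (Fin 3)) a,
    ENNReal.ofReal (frobeniusNormSq (H₀ y)) with hJ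
  have hf : AEMeasurable (fun y => ENNReal.ofReal (frobeniusNormSq (H₀ y)))
      (volume.restrict (ball (0 : EuclideanSpace ℝ (Fin 3)) a)) :=
    (ENNReal.continuous_ofReal.comp LerayHopfProofs.continuous_frobeniusNormSq).comp_aestronglyMeasurable
      hH₀.restrict |>.aemeasurable
  have hEeq : cknE a ((0 : ℝ), (0 : EuclideanSpace ℝ (Fin 3))) (fun _ => H₀) = ENNReal.ofReal a * J := by
    unfold cknE parabolicCylinder
    rw [setLIntegral_Ioo_prod_snd hf, Real.volume_Ioo, show (0 : ℝ) - (0 - a ^ 2) = a ^ 2 by ring,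
      ← mul_assoc, ENNReal.ofReal_pow ha.le, pow_two, ← mul_assoc,
      ENNReal.inv_mul_cancel ((ENNReal.ofReal_pos.2 ha).ne') ENNReal.ofReal_ne_top, one_mul]
  rw [hEeq, ← mul_assoc, ← ENNReal.ofReal_mul (Real.rpow_nonneg ha.le _)] at hE
  have hpos : 0 < a ^ ρ * a := mul_pos (Real.rpow_pos_of_pos ha ρ) ha
  have h1 : J ≤ ENNReal.ofReal c / ENNReal.ofReal (a ^ ρ * a) := by
    rw [ENNReal.le_div_iff_mul_le (Or.inl (ENNReal.ofReal_pos.2 hpos).ne') (Or.inl ENNReal.ofReal_ne_top),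
      mul_comm]
    exact hE
  refine h1.trans (le_of_eq ?_)
  rw [← ENNReal.ofReal_div_of_pos hpos]
  congr 1
  rw [show (-1 : ℝ) - ρ = -(ρ + 1) by ring, Real.rpow_neg ha.le, Real.rpow_add ha, Real.rpow_one,
    div_eq_mul_inv]

/-- **A steady gradient field with the gauged `E`-bound for all `a > 0` vanishes a.e.** (`ρ > −1`
suffices; here `ρ > 0`): `∫_{B_a}|H₀|²_F ≤ c·a^{−1−ρ} → 0`, and the ball integrals increase to
`∫_{ℝ³}|H₀|²_F`. [folklore] -/
theorem weakGradient_ae_zero_of_gaugedE_steady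
    {H₀ : EuclideanSpace ℝ (Fin 3) → EuclideanSpace ℝ (Fin 3) →L[ℝ] EuclideanSpace ℝ (Fin 3)}
    (hH₀ : AEStronglyMeasurable H₀ volume) {ρ c : ℝ} (hρ : 0 < ρ)
    (hE : ∀ a : ℝ, 0 < a → ENNReal.ofReal (a ^ ρ) *
      cknE a ((0 : ℝ), (0 : EuclideanSpace ℝ (Fin 3))) (fun _ => H₀) ≤ ENNReal.ofReal c) :
    ∀ᵐ y ∂volume, H₀ y = 0 := by
  set f : EuclideanSpace ℝ (Fin 3) → ℝ≥0∞ := fun y => ENNReal.ofReal (frobeniusNormSq (H₀ y)) with hf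
  have hfm : AEMeasurable f volume :=
    ((ENNReal.continuous_ofReal.comp LerayHopfProofs.continuous_frobeniusNormSq).comp_aestronglyMeasurable hH₀).aemeasurable
  -- the whole-space integral is the limit of the ball integrals, each `≤ c a^{-1-ρ}`
  have hball : ∀ n : ℕ, ∫⁻ y in ball (0 : EuclideanSpace ℝ (Fin 3)) ((n : ℝ) + 1), f y ≤
      ENNReal.ofReal (c * ((n : ℝ) + 1) ^ (-1 - ρ)) := fun n =>
    lintegral_ball_frobeniusNormSq_le_of_gaugedE hH₀ (by positivity) (hE _ (by positivity))
  have hlim0 : Tendsto (fun n : ℕ => ENNReal.ofReal (c * ((n : ℝ) + 1) ^ (-1 - ρ))) atTop (𝓝 0) := by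
    have h1 : Tendsto (fun n : ℕ => ((n : ℝ) + 1) ^ (-1 - ρ)) atTop (𝓝 0) := by
      have ht : Tendsto (fun n : ℕ => (n : ℝ) + 1) atTop atTop :=
        tendsto_natCast_atTop_atTop.atTop_add tendsto_const_nhds
      exact (tendsto_rpow_neg_atTop (by linarith : 0 < 1 + ρ)).comp ht |>.congr fun n => by
        simp only [comp_apply]; rw [show -(1 + ρ) = -1 - ρ by ring]
    have h2 := (h1.const_mul c)
    rw [mul_zero] at h2
    have h3 := ENNReal.tendsto_ofReal h2
    rwa [ENNReal.ofReal_zero] at h3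
  have htot : ∫⁻ y, f y = 0 := by
    -- monotone convergence over the exhausting balls
    have hmono : Monotone fun n : ℕ => ball (0 : EuclideanSpace ℝ (Fin 3)) ((n : ℝ) + 1) :=
      fun m n hmn => ball_subset_ball (by
        have : (m : ℝ) ≤ n := by exact_mod_cast hmn
        linarith)
    have hU : (⋃ n : ℕ, ball (0 : EuclideanSpace ℝ (Fin 3)) ((n : ℝ) + 1)) = univ := by
      refine eq_univ_of_forall fun y => mem_iUnion.2 ?_
      obtain ⟨n, hn⟩ := exists_nat_gt ‖y‖
      exact ⟨n, mem_ball_zero_iff.2 (hn.trans (lt_add_one _))⟩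
    have hsup : ∫⁻ y, f y = ⨆ n : ℕ, ∫⁻ y in ball (0 : EuclideanSpace ℝ (Fin 3)) ((n : ℝ) + 1), f y := by
      rw [← setLIntegral_univ, ← hU, setLIntegral_iUnion_of_directed f hmono.directed_le]
    rw [hsup]
    refine le_antisymm (iSup_le fun n => ?_) bot_le
    -- `∫_{B_{n+1}} f ≤ ∫_{B_{m+1}} f ≤ c (m+1)^{-1-ρ}` for all `m ≥ n`, and the right side → 0
    refine ge_of_tendsto hlim0 (eventually_atTop.2 ⟨n, fun m hm => ?_⟩)
    exact (lintegral_mono_set (hmono hm)).trans (hball m)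
  -- `∫ f = 0` ⇒ `f = 0` a.e. ⇒ `H₀ = 0` a.e.
  have hae : ∀ᵐ y ∂volume, f y = 0 := (lintegral_eq_zero_iff' hfm).1 htot
  filter_upwards [hae] with y hy
  have h1 : frobeniusNormSq (H₀ y) ≤ 0 := ENNReal.ofReal_eq_zero.1 hy
  have h2 : ‖H₀ y‖ ^ 2 ≤ 0 := (sq_opNorm_le_frobeniusNormSq _).trans h1
  exact norm_eq_zero.1 (by nlinarith [norm_nonneg (H₀ y)])

/-! ## The steady stratum (steady field, steady weak gradient) -/

/-- **A steady field with steady weak gradient obeying the gauged `E`-bound is a.e. constant.**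
`u(t, ·) = U`, `H(t, ·) = H₀` on the slab `(−∞, 0) × ℝ³`, `H` a weak spatial gradient of `u` there,
`a^ρ E(H; Q_a(0)) ≤ c` for all `a > 0` (`ρ > 0`) ⇒ `U = b` a.e. for some `b`. [folklore] -/
theorem powerGauge_steady_ae_const {U : EuclideanSpace ℝ (Fin 3) → EuclideanSpace ℝ (Fin 3)}
    {H₀ : EuclideanSpace ℝ (Fin 3) → EuclideanSpace ℝ (Fin 3) →L[ℝ] EuclideanSpace ℝ (Fin 3)}
    (hH : HasWeakSpatialGradientOn (slab (EuclideanSpace ℝ (Fin 3)) (Iio 0) isOpen_Iio)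
      (fun _ => U) (fun _ => H₀))
    (hH₀ : AEStronglyMeasurable H₀ volume) {ρ c : ℝ} (hρ : 0 < ρ)
    (hE : ∀ a : ℝ, 0 < a → ENNReal.ofReal (a ^ ρ) *
      cknE a ((0 : ℝ), (0 : EuclideanSpace ℝ (Fin 3))) (fun _ => H₀) ≤ ENNReal.ofReal c) :
    ∃ b : EuclideanSpace ℝ (Fin 3), U =ᵐ[volume] fun _ => b := by
  have hH0 : ∀ᵐ y ∂volume, H₀ y = 0 := weakGradient_ae_zero_of_gaugedE_steady hH₀ hρ hE
  -- `H = 0` a.e. on the slab (product of the time axis with a null set)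
  have h0 : ∀ᵐ z ∂(volume.restrict (Iio (0 : ℝ) ×ˢ (univ : Set (EuclideanSpace ℝ (Fin 3))))),
      (fun _ : ℝ => H₀) z.1 z.2 = 0 := by
    refine ae_restrict_of_ae ?_
    have h1 : ∀ᵐ z ∂((volume : Measure ℝ).prod (volume : Measure (EuclideanSpace ℝ (Fin 3)))),
        H₀ z.2 = 0 :=
      (Measure.quasiMeasurePreserving_snd (μ := (volume : Measure ℝ))
        (ν := (volume : Measure (EuclideanSpace ℝ (Fin 3))))).ae hH0
    rw [Measure.volume_eq_prod]
    exact h1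
  have hslice := ae_slice_const_of_weakGradient_ae_zero isOpen_Iio hH h0
  -- some time `t < 0` is good
  have hne : (volume.restrict (Iio (0 : ℝ))) ≠ 0 := by
    rw [Ne, Measure.restrict_eq_zero, Real.volume_Iio]
    exact ENNReal.top_ne_zero
  haveI : (ae (volume.restrict (Iio (0 : ℝ)))).NeBot := ae_neBot.2 hne
  obtain ⟨t, ht⟩ := hslice.exists
  exact ht

/-- **The steady-with-steady-gradient stratum of `PowerGaugeEulerLiouville` (rung B, sub-stratum),
every `ρ > 0`.**  Let `u(t, ·) = U` on `(−∞, 0) × ℝ³` with steady weak spatial gradient `H(t, ·) = H₀`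
(a.e.-strongly measurable), and suppose the gauged bounds `a^{2ρ} A(u; Q_a(0)) ≤ c` and
`a^ρ E(H; Q_a(0)) ≤ c` hold for all `a > 0`.  Then `U = 0` a.e., i.e. `u = 0` a.e. on the slab:
the `E`-bound makes `U` a.e. constant (`powerGauge_steady_ae_const`) and the `A`-bound
`a^{2ρ} · a⁻¹ · |B₁| a³ ‖b‖² ≤ c` for all `a` kills the constant.  No Euler equation, pressure,
divergence-freeness or suitability is used. [folklore] -/
theorem powerGauge_steady_eq_zero {U : EuclideanSpace ℝ (Fin 3) → EuclideanSpace ℝ (Fin 3)}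
    {H₀ : EuclideanSpace ℝ (Fin 3) → EuclideanSpace ℝ (Fin 3) →L[ℝ] EuclideanSpace ℝ (Fin 3)}
    (hH : HasWeakSpatialGradientOn (slab (EuclideanSpace ℝ (Fin 3)) (Iio 0) isOpen_Iio)
      (fun _ => U) (fun _ => H₀))
    (hH₀ : AEStronglyMeasurable H₀ volume) {ρ c : ℝ} (hρ : 0 < ρ) (hc : 0 ≤ c)
    (hA : ∀ a : ℝ, 0 < a → ENNReal.ofReal (a ^ (2 * ρ)) *
      cknA a ((0 : ℝ), (0 : EuclideanSpace ℝ (Fin 3))) (fun _ => U) ≤ ENNReal.ofReal c)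
    (hE : ∀ a : ℝ, 0 < a → ENNReal.ofReal (a ^ ρ) *
      cknE a ((0 : ℝ), (0 : EuclideanSpace ℝ (Fin 3))) (fun _ => H₀) ≤ ENNReal.ofReal c) :
    U =ᵐ[volume] fun _ => 0 := by
  obtain ⟨b, hb⟩ := powerGauge_steady_ae_const hH hH₀ hρ hE
  -- the `A`-bound: `a^{2ρ} · a⁻¹ · ‖b‖² |B_a| ≤ c` for all `a > 0`
  suffices hb0 : b = 0 by rw [hb0] at hb; exact hb
  by_contra hne
  have hbpos : 0 < ‖b‖ := norm_pos_iff.2 hne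
  set V : ℝ≥0∞ := volume (ball (0 : EuclideanSpace ℝ (Fin 3)) 1) with hV
  have hV0 : V ≠ 0 := (measure_ball_pos volume _ one_pos).ne'
  have hVtop : V ≠ ⊤ := measure_ball_lt_top.ne
  -- lower bound for `A`: the slice integral over `B_a` of the constant `b`
  have hAlow : ∀ a : ℝ, 0 < a →
      ENNReal.ofReal (a ^ 2 * ‖b‖ ^ 2) * V ≤ cknA a ((0 : ℝ), (0 : EuclideanSpace ℝ (Fin 3))) (fun _ => U) := by
    intro a ha
    -- at the time `t = -a²/2 ∈ (-a², 0)`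
    have ht : (-(a ^ 2) / 2 : ℝ) ∈ Ioo ((0 : ℝ) - a ^ 2) 0 := by
      constructor <;> nlinarith [sq_pos_of_pos ha]
    unfold cknA
    refine le_trans ?_ (le_iSup₂ (f := fun t (_ : t ∈ Ioo ((0 : ℝ) - a ^ 2) 0) =>
      (ENNReal.ofReal a)⁻¹ * ∫⁻ x in ball (0 : EuclideanSpace ℝ (Fin 3)) a, ‖U x‖ₑ ^ 2) _ ht)
    -- `∫_{B_a} ‖U‖² = ‖b‖² |B_a| = ‖b‖² a³ V`
    have hint : ∫⁻ x in ball (0 : EuclideanSpace ℝ (Fin 3)) a, ‖U x‖ₑ ^ 2 =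
        ‖b‖ₑ ^ 2 * volume (ball (0 : EuclideanSpace ℝ (Fin 3)) a) := by
      rw [← setLIntegral_const]
      refine setLIntegral_congr_fun_ae measurableSet_ball ?_
      filter_upwards [hb] with x hx _
      rw [hx]
    rw [hint, Measure.addHaar_ball_of_pos volume 0 ha, finrank_euclideanSpace_fin, ← hV]
    -- compare the scalar factors (they are equal)
    have hbe : ‖b‖ₑ ^ 2 = ENNReal.ofReal (‖b‖ ^ 2) := by
      rw [← ofReal_norm, ← ENNReal.ofReal_pow (norm_nonneg _)]
    refine le_of_eq ?_
    rw [hbe, ← ENNReal.ofReal_inv_of_pos ha, ← mul_assoc, ← mul_assoc,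
      ← ENNReal.ofReal_mul (inv_nonneg.2 ha.le), ← ENNReal.ofReal_mul (by positivity)]
    congr 2
    field_simp
  -- combine with the gauged `A`-bound and let `a → ∞`
  have hchain : ∀ a : ℝ, 0 < a →
      ENNReal.ofReal (a ^ (2 * ρ) * (a ^ 2 * ‖b‖ ^ 2)) * V ≤ ENNReal.ofReal c := by
    intro a ha
    calc ENNReal.ofReal (a ^ (2 * ρ) * (a ^ 2 * ‖b‖ ^ 2)) * V
        = ENNReal.ofReal (a ^ (2 * ρ)) * (ENNReal.ofReal (a ^ 2 * ‖b‖ ^ 2) * V) := by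
          rw [ENNReal.ofReal_mul (Real.rpow_nonneg ha.le _), mul_assoc]
      _ ≤ ENNReal.ofReal (a ^ (2 * ρ)) * cknA a ((0 : ℝ), (0 : EuclideanSpace ℝ (Fin 3))) (fun _ => U) :=
          mul_le_mul' le_rfl (hAlow a ha)
      _ ≤ ENNReal.ofReal c := hA a ha
  -- the left side is unbounded in `a`: take `a` with `a^{2ρ+2} ‖b‖² V.toReal > c`
  have hVr : 0 < V.toReal := ENNReal.toReal_pos hV0 hVtop
  have htend : Tendsto (fun a : ℝ => a ^ (2 * ρ) * (a ^ 2 * ‖b‖ ^ 2) * V.toReal) atTop atTop := by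
    have h1 : Tendsto (fun a : ℝ => a ^ (2 * ρ + 2)) atTop atTop := tendsto_rpow_atTop (by linarith)
    have h2 := h1.atTop_mul_const (mul_pos (pow_pos hbpos 2) hVr)
    refine (tendsto_congr' ?_).1 h2
    filter_upwards [eventually_gt_atTop 0] with a ha
    rw [Real.rpow_add ha, show (2 : ℝ) = ((2 : ℕ) : ℝ) by norm_num, Real.rpow_natCast]
    ring
  obtain ⟨a, hac, ha0⟩ := ((htend.eventually_gt_atTop c).and (eventually_gt_atTop 0)).exists
  have h := hchain a ha0
  rw [← ENNReal.ofReal_toReal hVtop, ← ENNReal.ofReal_mul (by positivity)] at h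
  have h' := (ENNReal.ofReal_le_ofReal_iff hc).1 h
  linarith

/-- **The steady-with-steady-gradient stratum, in the crux's binder shape.**  Same as
`powerGauge_steady_eq_zero`, with the gauged bound stated as ONE sum
`a^{2ρ} A(u; Q_a(0)) + a^ρ E(H; Q_a(0)) + a^{2ρ} D(p; Q_a(0)) ≤ c` (`c : ℝ≥0`), exactly as in the
crux `EulerZoomLiouville.PowerGaugeEulerLiouville` (the pressure term is simply dropped); the
conclusion is the crux's `uncurry u =ᵐ 0` on the slab `(−∞, 0) × ℝ³` for the steady field
`u(t, ·) = U`.  At route birth the steady rung is the one-line wrapper feeding the crux's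
`IsSuitableWeakSolutionOn`/`HasWeakSpatialGradientOn` binders (suitability unused). [folklore] -/
theorem powerGauge_steady_ae_eq_zero_of_sum {U : EuclideanSpace ℝ (Fin 3) → EuclideanSpace ℝ (Fin 3)}
    {H₀ : EuclideanSpace ℝ (Fin 3) → EuclideanSpace ℝ (Fin 3) →L[ℝ] EuclideanSpace ℝ (Fin 3)}
    {p : ℝ → EuclideanSpace ℝ (Fin 3) → ℝ}
    (hH : HasWeakSpatialGradientOn (slab (EuclideanSpace ℝ (Fin 3)) (Iio 0) isOpen_Iio)
      (fun _ => U) (fun _ => H₀))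
    (hH₀ : AEStronglyMeasurable H₀ volume) {ρ : ℝ} (hρ : 0 < ρ) {c : ℝ≥0}
    (hsum : ∀ a : ℝ, 0 < a →
      ENNReal.ofReal (a ^ (2 * ρ)) * cknA a ((0 : ℝ), (0 : EuclideanSpace ℝ (Fin 3))) (fun _ => U) +
        ENNReal.ofReal (a ^ ρ) * cknE a ((0 : ℝ), (0 : EuclideanSpace ℝ (Fin 3))) (fun _ => H₀) +
        ENNReal.ofReal (a ^ (2 * ρ)) * cknD a ((0 : ℝ), (0 : EuclideanSpace ℝ (Fin 3))) p ≤
        (c : ℝ≥0∞)) :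
    uncurry (fun _ : ℝ => U) =ᵐ[volume.restrict (Iio (0 : ℝ) ×ˢ (univ : Set (EuclideanSpace ℝ (Fin 3))))]
      0 := by
  have hcoe : ((c : ℝ≥0) : ℝ≥0∞) = ENNReal.ofReal (c : ℝ) := (ENNReal.ofReal_coe_nnreal).symm
  have hA : ∀ a : ℝ, 0 < a → ENNReal.ofReal (a ^ (2 * ρ)) *
      cknA a ((0 : ℝ), (0 : EuclideanSpace ℝ (Fin 3))) (fun _ => U) ≤ ENNReal.ofReal (c : ℝ) :=
    fun a ha => (le_add_right (le_add_right le_rfl)).trans ((hsum a ha).trans_eq hcoe)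
  have hE : ∀ a : ℝ, 0 < a → ENNReal.ofReal (a ^ ρ) *
      cknE a ((0 : ℝ), (0 : EuclideanSpace ℝ (Fin 3))) (fun _ => H₀) ≤ ENNReal.ofReal (c : ℝ) :=
    fun a ha => (le_add_left le_rfl).trans ((le_add_right le_rfl).trans ((hsum a ha).trans_eq hcoe))
  have hU := powerGauge_steady_eq_zero hH hH₀ hρ c.2 hA hE
  -- lift the a.e. statement on `ℝ³` to the slab
  refine ae_restrict_of_ae ?_
  have h1 : ∀ᵐ z ∂((volume : Measure ℝ).prod (volume : Measure (EuclideanSpace ℝ (Fin 3)))),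
      U z.2 = 0 :=
    (Measure.quasiMeasurePreserving_snd (μ := (volume : Measure ℝ))
      (ν := (volume : Measure (EuclideanSpace ℝ (Fin 3))))).ae hU
  rw [Measure.volume_eq_prod]
  filter_upwards [h1] with z hz
  simpa [uncurry] using hz

end Summit.NavierStokesRegularity.NavierStokesRegularity.Theorems.TypeIliouvilleNoTypeII.PowerGaugeSteady

end
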